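import Summits.ValiantsHypothesis.ValiantsHypothesis.Theses.LangWeilTransfer
import Summits.ValiantsHypothesis.ValiantsHypothesis.Theorems.LangWeilTransferGoodReductionFactorCount
import Summits.ValiantsHypothesis.ValiantsHypothesis.Theorems.LangWeilTransferGoodReductionDescent
import Summits.ValiantsHypothesis.ValiantsHypothesis.Theorems.LangWeilTransferGoodReductionBounds
import Literature.NumberTheory.Sieve.BombieriAsymptoticSieveSigma0Comb

/-!
# LangWeilTransfer, support item `GoodReduction` (stmt-ValiantsHypothesis-6377) — PROVED

Route `LangWeilTransfer` of `ValiantsHypothesis`, support item `GoodReduction`: for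
`Q ∈ ℤ[x_0..x_m]` irreducible over `ℚ` with `0 < g ≤ f` geometric components, outside a set of at
most `a((f+1)(m+1)(deg Q+1)(log₂ wt Q+1))^a` primes `p`, `Q mod p` has an absolutely irreducible
factor defined over `GaloisField p f'` for some `1 ≤ f' ≤ f`. Proved here with `a = 18` by the
HEIGHT-FREE Gao–Ruppert route (no Kronecker model, no heights of algebraic numbers):

1. `Q` is squarefree over `ℚ̄` with `r ≤ g` pairwise non-associated absolute factors
   (`LangWeilTransferGoodReductionFactorCount`);
2. Gao's theorem (`dim ker R_φ = #factors`, tree `Literature/RingTheory/MvPolynomial/RuppertGao*`)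
   for the generic plane section `φ` of `Q` gives a non-zero minor of size `N − r` of Ruppert's
   matrix over `ℤ[z, μ, v]`, hence a non-zero integer coefficient `c` with
   `log₂ |c| ≤ 16((d+1)(log₂ W+1))⁴` (`LangWeilTransferGoodReductionBounds`);
3. for `p > d`, `p ∤ c`, `p ∤` (one top coefficient of `Q`), the sections of the absolute factors
   of `Q mod p` are independent kernel pairs of the reduced matrix, so their number is `≤ r`
   (tree `Ruppert.card_add_le_of_map_rupMinor_ne_zero`);
4. the Frobenius orbit of an absolute factor then has length `e ≤ r ≤ f`, and the factor descends to
   `GaloisField p e` (`LangWeilTransferGoodReductionDescent`).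

Honest framing: a support item of a dormant conditional route (its cruxes `ShatteringExclusion`,
`TameResolution`, `P^#P ⊄ P/poly` stay open); VP ≠ VNP is NOT proved and nothing here bears on it.
-/

noncomputable section

open MvPolynomial

-- the summit and the problem share the name `ValiantsHypothesis` (D-0017 single-conjunct layout)
set_option linter.dupNamespace false

namespace Summit.ValiantsHypothesis.ValiantsHypothesis.Theorems.LangWeilTransfer

open Literature.RingTheory.MvPolynomial
open Literature.RingTheory.MvPolynomial.Ruppert
open Literature.Computability.AlgebraicComplexity (weight)

/-- **`GoodReduction` (stmt-ValiantsHypothesis-6377), general case, with exponent `a = 18`.** -/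
theorem goodReduction_proof : Summit.ValiantsHypothesis.ValiantsHypothesis.Theses.LangWeilTransfer.GoodReduction := by
  classical
  refine ⟨18, fun m f Q hQirr hpos hle => ?_⟩
  -- notation
  set d := Q.totalDegree with hd
  set W := weight Q with hW
  set L := Nat.log 2 W with hL
  obtain ⟨P, hP⟩ : ∃ P, (f + 1) * (m + 1) * (d + 1) * (L + 1) = P := ⟨_, rfl⟩
  have hQ0 : Q ≠ 0 := by
    rintro rfl; rw [map_zero] at hQirr; exact hQirr.ne_zero rfl
  -- `d ≥ 1`: an irreducible polynomial over `ℚ` is non-constant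
  have hd1 : 1 ≤ d := by
    by_contra h
    have h0 : Q.totalDegree = 0 := by omega
    rw [totalDegree_eq_zero_iff_eq_C] at h0
    have hc : Q.coeff 0 ≠ 0 := fun hc => hQ0 (by rw [h0, hc, C_0])
    apply hQirr.not_isUnit
    rw [h0, map_C]
    exact (isUnit_iff_ne_zero.mpr ((map_ne_zero_iff _ (Int.castRingHom ℚ).injective_int).mpr hc)).map C
  -- a top coefficient of `Q`
  obtain ⟨α₀, hα₀mem, hα₀⟩ : ∃ s ∈ Q.support, (s.sum fun _ e => e) = d := by
    obtain ⟨s, hs, h⟩ := Finset.exists_mem_eq_sup Q.support (support_nonempty.mpr hQ0)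
      (fun s : Fin (m + 1) →₀ ℕ => s.sum fun _ e => e)
    exact ⟨s, hs, by rw [← h]; rfl⟩
  have hcoeffW : ∀ e, (Q.coeff e).natAbs ≤ W := by
    intro e
    by_cases he : e ∈ Q.support
    · exact Finset.single_le_sum (f := fun e => (Q.coeff e).natAbs) (fun _ _ => Nat.zero_le _) he
    · rw [notMem_support_iff.mp he]; exact Nat.zero_le _
  -- the integer minor
  obtain ⟨r, k, rows, cs, e, hrg, hkr, hce, hcount⟩ := exists_int_coeff_minor Q hQirr hd1 hpos
  set c := (rupMinor d (planeSect Q) rows cs).coeff e with hc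
  have hclog : Nat.log 2 c.natAbs ≤ 16 * ((d + 1) * (L + 1)) ^ 4 :=
    log_coeff_rupMinor_le Q hd1 (by omega) rows cs e
  -- the bad primes
  set bad : Finset ℕ := c.natAbs.primeFactors ∪ (Q.coeff α₀).natAbs.primeFactors ∪ Finset.range (d + 1)
    with hbad
  refine ⟨bad, ?_, fun p _ hp => ?_⟩
  · -- the count
    have hP1 : 1 ≤ P := by rw [← hP]; exact Nat.succ_le_of_lt (by positivity)
    have hP₀ : (d + 1) * (L + 1) ≤ P := by
      rw [← hP]
      calc (d + 1) * (L + 1) = 1 * 1 * (d + 1) * (L + 1) := by ring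
        _ ≤ (f + 1) * (m + 1) * (d + 1) * (L + 1) :=
          Nat.mul_le_mul_right _ (Nat.mul_le_mul_right _ (Nat.mul_le_mul (by omega) (by omega)))
    have hdP : d + 1 ≤ P := le_trans (Nat.le_mul_of_pos_right _ (by omega)) hP₀
    have hLP : L ≤ P := le_trans (by nlinarith : L ≤ (d + 1) * (L + 1)) hP₀
    have h1 : c.natAbs.primeFactors.card ≤ 16 * P ^ 4 :=
      (Literature.NumberTheory.Sieve.BombieriSieve.card_primeFactors_le_log _).trans
        (hclog.trans (Nat.mul_le_mul_left _ (Nat.pow_le_pow_left hP₀ 4)))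
    have h2 : (Q.coeff α₀).natAbs.primeFactors.card ≤ P :=
      (Literature.NumberTheory.Sieve.BombieriSieve.card_primeFactors_le_log _).trans
        ((Nat.log_mono_right (hcoeffW α₀)).trans hLP)
    have h3 : (Finset.range (d + 1)).card ≤ P := by rw [Finset.card_range]; exact hdP
    calc bad.card ≤ (c.natAbs.primeFactors ∪ (Q.coeff α₀).natAbs.primeFactors).card + (Finset.range (d + 1)).card :=
          Finset.card_union_le _ _
      _ ≤ (c.natAbs.primeFactors.card + (Q.coeff α₀).natAbs.primeFactors.card) + (Finset.range (d + 1)).card :=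
          Nat.add_le_add_right (Finset.card_union_le _ _) _
      _ ≤ 16 * P ^ 4 + P + P := by omega
      _ ≤ 18 * P ^ 4 := by nlinarith [Nat.le_self_pow (by norm_num : 4 ≠ 0) P]
      _ ≤ 18 * P ^ 18 := Nat.mul_le_mul_left _ (Nat.pow_le_pow_right hP1 (by norm_num))
      _ = 18 * ((f + 1) * (m + 1) * (d + 1) * (Nat.log 2 (weight Q) + 1)) ^ 18 := by rw [hP]
  · -- a good prime
    have hpc : ¬ (p : ℤ) ∣ c := by
      intro h
      apply hp
      rw [hbad, Finset.mem_union, Finset.mem_union]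
      refine Or.inl (Or.inl (Nat.mem_primeFactors.mpr ⟨Fact.out, Int.natCast_dvd.mp h, ?_⟩))
      exact Int.natAbs_ne_zero.mpr hce
    have hpα : ¬ (p : ℤ) ∣ Q.coeff α₀ := by
      intro h
      apply hp
      rw [hbad, Finset.mem_union, Finset.mem_union]
      refine Or.inl (Or.inr (Nat.mem_primeFactors.mpr ⟨Fact.out, Int.natCast_dvd.mp h, ?_⟩))
      exact Int.natAbs_ne_zero.mpr (mem_support_iff.mp hα₀mem)
    have hpd : d < p := by
      by_contra h
      apply hp
      rw [hbad, Finset.mem_union]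
      exact Or.inr (Finset.mem_range.mpr (by omega))
    -- `Q mod p` is a non-zero non-unit
    have hQp_coeff : (MvPolynomial.map (Int.castRingHom (ZMod p)) Q).coeff α₀ ≠ 0 := by
      rw [coeff_map, eq_intCast, Ne, ZMod.intCast_zmod_eq_zero_iff_dvd]
      exact hpα
    have hQp0 : MvPolynomial.map (Int.castRingHom (ZMod p)) Q ≠ 0 := fun h =>
      hQp_coeff (by rw [h, coeff_zero])
    have hQpu : ¬ IsUnit (MvPolynomial.map (Int.castRingHom (ZMod p)) Q) := by
      intro hu
      have h0 := (MvPolynomial.isUnit_iff_totalDegree_of_isReduced.mp hu).2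
      have h1 := le_totalDegree (mem_support_iff.mpr hQp_coeff)
      rw [hα₀, h0] at h1
      omega
    -- the count over `𝔽̄_p`
    haveI : CharP (AlgebraicClosure (ZMod p)) p :=
      charP_of_injective_algebraMap (algebraMap (ZMod p) (AlgebraicClosure (ZMod p))).injective p
    have hQL0 : MvPolynomial.map (Int.castRingHom (AlgebraicClosure (ZMod p))) Q ≠ 0 := by
      have hcomp : (algebraMap (ZMod p) (AlgebraicClosure (ZMod p))).comp (Int.castRingHom (ZMod p)) =
          Int.castRingHom _ := RingHom.ext_int _ _
      rw [← hcomp, ← MvPolynomial.map_map]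
      exact (map_ne_zero_iff _ (MvPolynomial.map_injective _ (algebraMap (ZMod p) _).injective)).mpr hQp0
    have hbound := hcount p hpd hpc (L := AlgebraicClosure (ZMod p)) hQL0
    -- Frobenius descent
    obtain ⟨e', he'0, he'r, Q₁, hQ₁irr, hQ₁dvd⟩ :=
      exists_absIrreducible_factor_galoisField p Q (g := r) hQp0 hQpu hbound
    exact ⟨e', he'0, by omega, Q₁, hQ₁irr, hQ₁dvd⟩

end Summit.ValiantsHypothesis.ValiantsHypothesis.Theorems.LangWeilTransfer
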